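import Mathlib
import Summits.QuantumFields.QCD.Theses.PauliWegnerSea
import Summits.QuantumFields.QCD.Theorems.PauliWegnerSeaFMClosureUnquenchedRepairedC2
import Summits.QuantumFields.QCD.Theorems.PauliWegnerSeaFMClosureUnquenchedRepairedC2BetaFloor
import Summits.QuantumFields.QCD.Theorems.PauliWegnerSeaFMClosureUnquenchedRepairedC2Apriori

/-!
# `FMClosureUnquenchedPrime` — restatement texts for crux K2 (stmt-QuantumFields-11512) that are BORN CLOSED

Lead report `Cruxes/FMClosureUnquenched/LEAD-c2.md` (continuation lead c2, line `von-mises-circles`).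
This crux WORKFILE (not a Theorems file; nothing here is registered) gives the planner copy-paste statement texts, each with
its closing theorem already LANDED under `Theorems/` (p141195, p141628, p141953):

* **Option A (`2 ≤ ℓ₀`).** `CoreOutwardFromTwo` — the core of K2 repaired at its two over-quantified corners and nothing
  else: the one-scale input asks `2 ≤ ℓ₀` (A5) and clause (ii) is asked OUTWARD, for `K (1 + |log a_k|) ≤ a_k ‖v‖` (A6);
  integrands byte-identical with the route's `FMClosureUnquenched`; NO sign condition on `β_k`, NO bare-mass range, NO mass
  positivity.  `FMClosureUnquenchedPrime := LocalCofactorDomination → (∀ N_f, FarStability N_f) → CoreOutwardFromTwo`,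
  closed by `fmClosureUnquenchedPrime_holds` (= `VonMisesCirclesC2.coreOutward_of_localCofactorDomination_farStability`).
* **Option B (input VERBATIM, coupling floor).** `CoreOutwardBetaFloor` — the crux's one-scale input AS TYPED (`1 ≤ ℓ₀`),
  clause (ii) OUTWARD, under the extra hypothesis `∃ β₀ > 0, ∀ᶠ k, β₀ ≤ |β_k|`, which `HasAsymptoticScaling` of any scheme of
  the regularisation discharges for `N_f ≤ 16` (`VonMisesCirclesC2.betaFloor_of_hasAsymptoticScaling`): nothing changes in
  the trajectory item's one-scale text.  `FMClosureUnquenchedPrimeB := LocalCofactorDomination → (∀ N_f, FarStability N_f) →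
  CoreOutwardBetaFloor`, closed by `fmClosureUnquenchedPrimeB_holds`.
* **The honest inward statement.** `InwardApriori` — under K1♭ alone the crux's moment is `≤ C (1 + |β|)^p` for all
  couplings, masses, volumes, flavours and `v ∈ box S` (`VonMisesCirclesC2.cruxMoment_apriori`); this is what is true
  inside the window where the crux as typed asked for decay.

What the restatement does NOT contain and the planner must file separately (LEAD-c2.md §Recommendation): the two
antecedents as crux items (`LocalCofactorDomination` — same mechanism and same kill as stmt-11510, recommended as ITS
restatement; `∀ Nf, FarStability Nf` — the physical crux), and the outward-only reading of the shared clause (ii)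
downstream (stmt-9151 / `MobilityGap` (ii), shared with route WilsonMobilityGap).
-/

namespace Summit.QuantumFields.QCD.Cruxes.FMClosureUnquenched.Prime

open scoped BigOperators
open MeasureTheory Filter
open Literature.MathematicalPhysics.QuantumFieldTheory Literature.MathematicalPhysics.QuantumLattice
  Literature.Probability.LatticeModels
open Summit.QuantumFields.QCD.Theorems.VonMisesCircles
open Summit.QuantumFields.QCD.Theorems.VonMisesCirclesC2

/-! ## Option A: input with `2 ≤ ℓ₀`, outward conclusion -/

/-- **The repaired core of K2, option A** (candidate statement text): for every `N_f`, every regularisation and every mass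
tuple, the one-scale input WITH `2 ≤ ℓ₀` implies clause (ii) OUTWARD (for `K (1 + |log a_k|) ≤ a_k ‖v‖`).
Integrands byte-identical with `PauliWegnerSea.FMClosureUnquenched`. -/
def CoreOutwardFromTwo : Prop :=
  ∀ (Nf : ℕ) (reg : QCDRegularisation Nf) (m : Fin Nf → ℝ),
    (∀ q : ℕ, ∃ K₀ s : ℝ, 0 < s ∧ s < 1 ∧ ∀ᶠ k in atTop, ∃ ℓ₀ : ℕ, 2 ≤ ℓ₀ ∧ ℓ₀ ≤ reg.L k ∧
      (ℓ₀ : ℝ) * reg.a k ≤ K₀ * (1 + |Real.log (reg.a k)|) ∧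
      ∀ S : ℕ, reg.L k ≤ S → ∀ (f : Fin Nf) (v : Literature.Probability.LatticeModels.Site 4),
        v ∈ box 4 S → ‖v‖ = (ℓ₀ : ℝ) →
          (ℓ₀ : ℝ) ^ q * (1 + |reg.β k|) ^ q *
            ((∫ U : GaugeConfig 4 (2 * S + 1) (Matrix.specialUnitaryGroup (Fin 3) ℂ),
                ‖(diracMatrix U fun fl => reg.mcrit k + reg.a k * m fl / reg.Zm k).det‖ *
                  (∑ a : Fin 3, ∑ i : Fin 4, ∑ b : Fin 3, ∑ j : Fin 4,
                    ‖(diracMatrix U fun fl => reg.mcrit k + reg.a k * m fl / reg.Zm k)⁻¹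
                      (quarkEquiv (f, (Torus.proj (2 * S + 1) 0, a, i)))
                      (quarkEquiv (f, (Torus.proj (2 * S + 1) (v), b, j)))‖) ^ s
                ∂(wilsonMeasure (fundamentalRep (Fin 3)) (reg.β k))) /
              (∫ U : GaugeConfig 4 (2 * S + 1) (Matrix.specialUnitaryGroup (Fin 3) ℂ),
                ‖(diracMatrix U fun fl => reg.mcrit k + reg.a k * m fl / reg.Zm k).det‖
                ∂(wilsonMeasure (fundamentalRep (Fin 3)) (reg.β k)))) ≤ 1) →
    ∃ s δ C K : ℝ, 0 < s ∧ s < 1 ∧ 0 < δ ∧ ∀ᶠ k in atTop, ∀ S : ℕ, reg.L k ≤ S →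
      ∀ (f : Fin Nf) (v : Literature.Probability.LatticeModels.Site 4), v ∈ box 4 S →
        K * (1 + |Real.log (reg.a k)|) ≤ reg.a k * ‖v‖ →
          (∫ U : GaugeConfig 4 (2 * S + 1) (Matrix.specialUnitaryGroup (Fin 3) ℂ),
              ‖(diracMatrix U fun fl => reg.mcrit k + reg.a k * m fl / reg.Zm k).det‖ *
                (∑ a : Fin 3, ∑ i : Fin 4, ∑ b : Fin 3, ∑ j : Fin 4,
                  ‖(diracMatrix U fun fl => reg.mcrit k + reg.a k * m fl / reg.Zm k)⁻¹
                    (quarkEquiv (f, (Torus.proj (2 * S + 1) 0, a, i)))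
                    (quarkEquiv (f, (Torus.proj (2 * S + 1) (v), b, j)))‖) ^ s
              ∂(wilsonMeasure (fundamentalRep (Fin 3)) (reg.β k))) /
            (∫ U : GaugeConfig 4 (2 * S + 1) (Matrix.specialUnitaryGroup (Fin 3) ℂ),
              ‖(diracMatrix U fun fl => reg.mcrit k + reg.a k * m fl / reg.Zm k).det‖
              ∂(wilsonMeasure (fundamentalRep (Fin 3)) (reg.β k))) ≤
            C * Real.exp (-(δ * (reg.a k * ‖v‖)))

/-- **K2′, option A**: K1♭ and far stability (both by name, from the landed Defs file) imply the repaired core. -/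
def FMClosureUnquenchedPrime : Prop :=
  LocalCofactorDomination → (∀ Nf : ℕ, FarStability Nf) → CoreOutwardFromTwo

/-- **K2′ (option A) holds outright** — by the landed `VonMisesCirclesC2.coreOutward_of_localCofactorDomination_farStability`
(p141195). -/
theorem fmClosureUnquenchedPrime_holds : FMClosureUnquenchedPrime :=
  fun hK hF => coreOutward_of_localCofactorDomination_farStability hK hF

/-! ## Option B: input verbatim, coupling floor, outward conclusion -/

/-- **The repaired core of K2, option B** (candidate statement text): for every `N_f`, every regularisation whose couplings
eventually satisfy `β₀ ≤ |β_k|` for some `β₀ > 0`, and every mass tuple, the crux's one-scale input VERBATIM (`1 ≤ ℓ₀`)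
implies clause (ii) OUTWARD.  Integrands byte-identical with `PauliWegnerSea.FMClosureUnquenched`. -/
def CoreOutwardBetaFloor : Prop :=
  ∀ (Nf : ℕ) (reg : QCDRegularisation Nf) (m : Fin Nf → ℝ),
    (∃ β₀ : ℝ, 0 < β₀ ∧ ∀ᶠ k in atTop, β₀ ≤ |reg.β k|) →
    (∀ q : ℕ, ∃ K₀ s : ℝ, 0 < s ∧ s < 1 ∧ ∀ᶠ k in atTop, ∃ ℓ₀ : ℕ, 1 ≤ ℓ₀ ∧ ℓ₀ ≤ reg.L k ∧
      (ℓ₀ : ℝ) * reg.a k ≤ K₀ * (1 + |Real.log (reg.a k)|) ∧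
      ∀ S : ℕ, reg.L k ≤ S → ∀ (f : Fin Nf) (v : Literature.Probability.LatticeModels.Site 4),
        v ∈ box 4 S → ‖v‖ = (ℓ₀ : ℝ) →
          (ℓ₀ : ℝ) ^ q * (1 + |reg.β k|) ^ q *
            ((∫ U : GaugeConfig 4 (2 * S + 1) (Matrix.specialUnitaryGroup (Fin 3) ℂ),
                ‖(diracMatrix U fun fl => reg.mcrit k + reg.a k * m fl / reg.Zm k).det‖ *
                  (∑ a : Fin 3, ∑ i : Fin 4, ∑ b : Fin 3, ∑ j : Fin 4,
                    ‖(diracMatrix U fun fl => reg.mcrit k + reg.a k * m fl / reg.Zm k)⁻¹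
                      (quarkEquiv (f, (Torus.proj (2 * S + 1) 0, a, i)))
                      (quarkEquiv (f, (Torus.proj (2 * S + 1) (v), b, j)))‖) ^ s
                ∂(wilsonMeasure (fundamentalRep (Fin 3)) (reg.β k))) /
              (∫ U : GaugeConfig 4 (2 * S + 1) (Matrix.specialUnitaryGroup (Fin 3) ℂ),
                ‖(diracMatrix U fun fl => reg.mcrit k + reg.a k * m fl / reg.Zm k).det‖
                ∂(wilsonMeasure (fundamentalRep (Fin 3)) (reg.β k)))) ≤ 1) →
    ∃ s δ C K : ℝ, 0 < s ∧ s < 1 ∧ 0 < δ ∧ ∀ᶠ k in atTop, ∀ S : ℕ, reg.L k ≤ S →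
      ∀ (f : Fin Nf) (v : Literature.Probability.LatticeModels.Site 4), v ∈ box 4 S →
        K * (1 + |Real.log (reg.a k)|) ≤ reg.a k * ‖v‖ →
          (∫ U : GaugeConfig 4 (2 * S + 1) (Matrix.specialUnitaryGroup (Fin 3) ℂ),
              ‖(diracMatrix U fun fl => reg.mcrit k + reg.a k * m fl / reg.Zm k).det‖ *
                (∑ a : Fin 3, ∑ i : Fin 4, ∑ b : Fin 3, ∑ j : Fin 4,
                  ‖(diracMatrix U fun fl => reg.mcrit k + reg.a k * m fl / reg.Zm k)⁻¹
                    (quarkEquiv (f, (Torus.proj (2 * S + 1) 0, a, i)))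
                    (quarkEquiv (f, (Torus.proj (2 * S + 1) (v), b, j)))‖) ^ s
              ∂(wilsonMeasure (fundamentalRep (Fin 3)) (reg.β k))) /
            (∫ U : GaugeConfig 4 (2 * S + 1) (Matrix.specialUnitaryGroup (Fin 3) ℂ),
              ‖(diracMatrix U fun fl => reg.mcrit k + reg.a k * m fl / reg.Zm k).det‖
              ∂(wilsonMeasure (fundamentalRep (Fin 3)) (reg.β k))) ≤
            C * Real.exp (-(δ * (reg.a k * ‖v‖)))

/-- **K2′, option B**. -/
def FMClosureUnquenchedPrimeB : Prop :=
  LocalCofactorDomination → (∀ Nf : ℕ, FarStability Nf) → CoreOutwardBetaFloor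

/-- **K2′ (option B) holds outright** — by the landed
`VonMisesCirclesC2.coreOutward_of_localCofactorDomination_farStability_betaFloor` (p141628). -/
theorem fmClosureUnquenchedPrimeB_holds : FMClosureUnquenchedPrimeB :=
  fun hK hF => coreOutward_of_localCofactorDomination_farStability_betaFloor hK hF

/-- The coupling floor of option B is automatic on asymptotically scaling trajectories with `N_f ≤ 16` (the assembly's
`N_f ∈ {2, 3}`): landed `VonMisesCirclesC2.betaFloor_of_hasAsymptoticScaling` (p141628), restated for the scheme the route's
trajectory items name (`reg.scheme 0 0 0`). -/
theorem betaFloor_of_trajectory {Nf : ℕ} (hNf : Nf ≤ 16) (reg : QCDRegularisation Nf)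
    (h : (reg.scheme 0 0 0).HasAsymptoticScaling) : ∃ β₀ : ℝ, 0 < β₀ ∧ ∀ᶠ k in atTop, β₀ ≤ |reg.β k| :=
  betaFloor_of_hasAsymptoticScaling hNf reg 0 0 0 h

/-! ## The honest inward statement -/

/-- **Global a-priori bound** (candidate statement text for what replaces clause (ii) INSIDE the window): under K1♭, for
every `N_f` there are `0 < s < 1`, `C ≥ 0`, `p` with the crux's moment `≤ C (1 + |β|)^p` for all couplings, mass tuples,
volumes, flavours and `v ∈ box S`. -/
def InwardApriori : Prop :=
  LocalCofactorDomination → ∀ Nf : ℕ, ∃ s C p : ℝ, 0 < s ∧ s < 1 ∧ 0 ≤ C ∧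
    ∀ (β : ℝ) (mq : Fin Nf → ℝ) (S : ℕ) (f : Fin Nf) (v : Literature.Probability.LatticeModels.Site 4),
      v ∈ box 4 S → cruxMoment Nf β mq S f v s ≤ C * (1 + |β|) ^ p

/-- `InwardApriori` holds — landed `VonMisesCirclesC2.cruxMoment_apriori` (p141953). -/
theorem inwardApriori_holds : InwardApriori :=
  cruxMoment_apriori

end Summit.QuantumFields.QCD.Cruxes.FMClosureUnquenched.Prime
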